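import Literature.Analysis.FluidPDE.NSGaldiDualityBounds
import Literature.Analysis.FluidPDE.DivCurlAnnihilator
import Literature.Analysis.FluidPDE.SolenoidalSlabDuality
import Mathlib.MeasureTheory.Measure.SeparableMeasure
import HarnessLib

/-!
# Galdi's class assertion, energy half: `L⁴(Q_T)` distributional solutions lie in `L^∞(0,T; L²)`

Analysis/FluidPDE proof file in the discharge of the class assertion
`Literature.Analysis.FluidPDE.galdi_lerayHopf_class` (`FluidPDE/NSGaldiEnergyEquality`) of Galdi's
theorem (Galdi 2019, Proc. AMS 147, Thm. 1.1): a distributional (pressure-free,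
divergence-free-tested) solution `v` of the unforced Navier–Stokes system on `E × (0,T)` with
datum `v₀ ∈ L²_σ` which lies in `L⁴(0,T; L⁴)` is in `L^∞(0,T; L²) ∩ L²(0,T; H¹)`. This file
proves the **first half**, `v ∈ L^∞(0,T; L²)` (accepted rendering `Fluid.MemLqLp ∞ 2 v (Ioo 0 T)`),
with the explicit bound `ess sup_t ‖v(t)‖_{L²} ≤ √(2/ν) ‖v‖²_{L⁴(Q_T)} + 2 ‖v₀‖_{L²}`
(`IsWeakNSSolutionOn.memLqLp_top_two_of_L4`).

## Proof (duality with curl-type fields; Galdi 2019, proof of Thm. 1.1, (2.12)–(2.15))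

1. **`L¹ₜL²ₓ` bound on finite sums of curl-type fields.** For scalar space–time tests `θₖ`
   vanishing for `t ≥ b` (`b < T`) and vectors `aₖ, cₖ`, the field
   `Φ = Σₖ [(∂_{aₖ}θₖ) cₖ - (∂_{cₖ}θₖ) aₖ]` satisfies the duality identity of the tree (accepted
   `IsWeakNSSolutionOn.integral_inner_curlPair_eq`, `FluidPDE/NSGaldiDualityIdentity`, summed over
   `k`: the identity is linear in the data), hence the accepted abstract `L¹ₜL²ₓ` bound
   `abs_integral_inner_le_L1_of_duality` (`FluidPDE/NSGaldiDualityBounds`):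
   `|∫∫ ⟪v, Φ⟫| ≤ A ∫₀ᵀ ‖Φ(s)‖₂ ds`, `A = √(2/ν) ‖v‖²_{L⁴(Q_T)} + 2‖v₀‖₂`
   (`IsWeakNSSolutionOn.abs_integral_inner_curlSum_le_L1`).
2. **Products.** With `Φ(t, x) = η(t) φ(x)`, `η ∈ C_c^∞((0,T))`, `φ` in the span `𝒦` of the
   curl-type fields of scalar tests on `E`, this reads `|∫₀ᵀ η(t) ⟨v(t), φ⟩ dt| ≤ A ‖φ‖₂ ∫|η|`, so
   `|⟨v(t), φ⟩| ≤ A‖φ‖₂` for a.e. `t` by the smooth `L¹`–`L^∞` duality of the tree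
   (`ae_abs_le_of_forall_abs_integral_mul_le`, `FluidPDE/L2DualityTools`)
   (`IsWeakNSSolutionOn.ae_abs_integral_inner_curlSum_le`).
3. **Exchange of quantifiers.** A countable subfamily of `𝒦` approximating every member
   simultaneously in `L²` and `L^{4/3}` (`exists_countable_seq_dense` applied in
   `L² × L^{4/3}`, second countable) carries the bound to "for a.e. `t`, for all `φ ∈ 𝒦`"
   (`v(t) ∈ L⁴` for a.e. `t`).
4. **`L²` by duality with curls.** For a.e. `t` the slice `v(t) ∈ L⁴` is weakly divergence free,
   so the accepted `memLp_two_of_forall_abs_integral_inner_curlPair_le`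
   (`FluidPDE/DivCurlAnnihilator`: Riesz on the closure of `𝒦` and the `div`–`curl` annihilator
   lemma) gives `v(t) ∈ L²` with `‖v(t)‖₂ ≤ A`.

No new definitions; the class `𝒦` appears as a `Submodule.span` of an explicitly described set.

## Mathlib / tree search

Mathlib: `Lp.SecondCountableTopology` (`MeasureTheory/Measure/SeparableMeasure`),
`Lp.tendsto_Lp_iff_tendsto_eLpNorm'`, `eLpNorm_le_eLpNorm_mul_eLpNorm_of_nnnorm`,
`Integrable.integral_prod_left`, `Submodule.span_induction`, `Fintype.sum_sum_type`. Tree: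
`NSGaldiDualityIdentity`/`NSGaldiDualityBounds` (identity, `L¹ₜL²ₓ` bound, slab tools),
`NSGaldiExtendedTest` (Hölder tools on the slab), `L2DualityTools`, `DivCurlAnnihilator`,
`SolenoidalSlabDuality` (product tests, `norm_toLp_sq_eq_integral_sq_norm`).

## References

* G. P. Galdi, *On the energy equality for distributional solutions to Navier–Stokes equations*,
  Proc. Amer. Math. Soc. 147 (2019), 785–792 (arXiv:1710.05725), Thm. 1.1 and its proof,
  (2.12)–(2.15). Bib key `Galdi2018`.
* P. G. Lemarié-Rieusset, *The Navier–Stokes problem in the 21st century*, CRC Press 2016,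
  Prop. 4.3 (B) (energy estimate of the Duhamel integral). Bib key `LemarieRieusset2016`.
-/

noncomputable section

open MeasureTheory TopologicalSpace Set Function Filter Topology InnerProductSpace Metric
open scoped RealInnerProductSpace ENNReal NNReal ContDiff Laplacian

namespace Literature.Analysis.FluidPDE

variable {E : Type*} [NormedAddCommGroup E] [InnerProductSpace ℝ E] [FiniteDimensional ℝ E]
  [MeasurableSpace E] [BorelSpace E]

/-- Local notation: the linear map `ℓ ↦ ℓ a • c - ℓ c • a` on covectors (as in
`NSGaldiExtendedTest`); composed with `Dg` it gives the curl-type field `(∂ₐ g) c - (∂_c g) a`. -/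
local notation3 "𝐋[" a ", " c "]" =>
  ((ContinuousLinearMap.apply ℝ ℝ a).smulRight c - (ContinuousLinearMap.apply ℝ ℝ c).smulRight a :
    (E →L[ℝ] ℝ) →L[ℝ] E)

/-! ### Test functions: finite sums, products, representations of the span of curl-type fields -/

section Tests

variable {X : Type*} [NormedAddCommGroup X] [NormedSpace ℝ X]
variable {F : Type*} [NormedAddCommGroup F] [NormedSpace ℝ F]

omit [InnerProductSpace ℝ E] [FiniteDimensional ℝ E] [MeasurableSpace E] [BorelSpace E] in
/-- Finite sums of test functions on the whole space are test functions. [folklore] -/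
theorem isTestFunctionOn_top_finset_sum {ι : Type*} (s : Finset ι) {g : ι → X → F}
    (hg : ∀ k ∈ s, FunctionSpaces.IsTestFunctionOn (⊤ : Opens X) (g k)) :
    FunctionSpaces.IsTestFunctionOn (⊤ : Opens X) fun x => ∑ k ∈ s, g k x := by
  classical
  refine ⟨ContDiff.sum fun k hk => (hg k hk).contDiff, ?_, by simp⟩
  induction s using Finset.induction_on with
  | empty =>
    simp only [Finset.sum_empty]
    exact HasCompactSupport.zero
  | insert i s hi ih =>
    have h1 : HasCompactSupport (g i) := (hg i (Finset.mem_insert_self i s)).hasCompactSupport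
    have h2 := ih fun k hk => hg k (Finset.mem_insert_of_mem hk)
    simp only [Finset.sum_insert hi]
    exact h1.add h2

omit [MeasurableSpace E] [BorelSpace E] [FiniteDimensional ℝ E] in
/-- Finite sums of space–time test fields on `ℝ × E` are space–time test fields. [folklore] -/
theorem isSpaceTimeTestOn_top_finset_sum {ι : Type*} (s : Finset ι) {g : ι → ℝ → E → F}
    (hg : ∀ k ∈ s, IsSpaceTimeTestOn (⊤ : Opens (ℝ × E)) (g k)) :
    IsSpaceTimeTestOn (⊤ : Opens (ℝ × E)) fun t x => ∑ k ∈ s, g k t x := by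
  have h := isTestFunctionOn_top_finset_sum s (g := fun k (p : ℝ × E) => g k p.1 p.2) hg
  exact h

omit [MeasurableSpace E] [BorelSpace E] [FiniteDimensional ℝ E] in
/-- The product `θ(t,x) = η(t) g(x)` of a smooth compactly supported `η : ℝ → ℝ` and a test
function `g` on `E` (any target) is a space–time test field on `ℝ × E`. [folklore] -/
theorem isSpaceTimeTestOn_smul_top' {η : ℝ → ℝ} (hη : ContDiff ℝ ∞ η)
    (hηc : HasCompactSupport η) {g : E → F} (hg : FunctionSpaces.IsTestFunctionOn (⊤ : Opens E) g) :
    IsSpaceTimeTestOn (⊤ : Opens (ℝ × E)) (fun t x => η t • g x) where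
  contDiff := (hη.comp contDiff_fst).smul (hg.contDiff.comp contDiff_snd)
  hasCompactSupport := by
    refine HasCompactSupport.intro (hηc.prod hg.hasCompactSupport) ?_
    rintro ⟨s, x⟩ hp
    rcases not_and_or.1 (fun h => hp (mem_prod.2 h)) with h | h
    · simp [uncurry, image_eq_zero_of_notMem_tsupport h]
    · simp [uncurry, image_eq_zero_of_notMem_tsupport h]
  tsupport_subset := by simp

omit [MeasurableSpace E] [BorelSpace E] [FiniteDimensional ℝ E] in
/-- **Elements of the span of the curl-type fields are finite sums of curl-type fields**
(scalars are absorbed into the vectors: `r ((∂ₐg) c - (∂_c g) a) = (∂ₐg)(rc) - (∂_{rc}g) a`). [folklore] -/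
theorem exists_curlSum_of_mem_span {φ : E → E}
    (hφ : φ ∈ Submodule.span ℝ {φ : E → E | ∃ (g : E → ℝ) (a c : E),
        FunctionSpaces.IsTestFunctionOn (⊤ : Opens E) g ∧
          φ = fun x => fderiv ℝ g x a • c - fderiv ℝ g x c • a}) :
    ∃ (ι : Type) (_ : Fintype ι) (g : ι → E → ℝ) (a c : ι → E),
      (∀ k, FunctionSpaces.IsTestFunctionOn (⊤ : Opens E) (g k)) ∧
        φ = fun x => ∑ k, (fderiv ℝ (g k) x (a k) • c k - fderiv ℝ (g k) x (c k) • a k) := by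
  induction hφ using Submodule.span_induction with
  | mem φ hφ =>
    obtain ⟨g, a, c, hg, rfl⟩ := hφ
    exact ⟨Unit, inferInstance, fun _ => g, fun _ => a, fun _ => c, fun _ => hg, by
      funext x; simp⟩
  | zero =>
    exact ⟨Empty, inferInstance, Empty.elim, Empty.elim, Empty.elim, fun k => k.elim, by
      funext x; simp⟩
  | add φ ψ _ _ h₁ h₂ =>
    obtain ⟨ι₁, _, g₁, a₁, c₁, hg₁, rfl⟩ := h₁
    obtain ⟨ι₂, _, g₂, a₂, c₂, hg₂, rfl⟩ := h₂
    refine ⟨ι₁ ⊕ ι₂, inferInstance, Sum.elim g₁ g₂, Sum.elim a₁ a₂, Sum.elim c₁ c₂,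
      fun k => by cases k <;> simp [hg₁, hg₂], ?_⟩
    funext x
    simp only [Pi.add_apply, Fintype.sum_sum_type, Sum.elim_inl, Sum.elim_inr]
  | smul r φ _ h =>
    obtain ⟨ι, _, g, a, c, hg, rfl⟩ := h
    refine ⟨ι, inferInstance, g, a, fun k => r • c k, hg, ?_⟩
    funext x
    simp only [Pi.smul_apply, Finset.smul_sum, map_smul, smul_eq_mul, smul_sub, mul_smul]
    refine Finset.sum_congr rfl fun k _ => ?_
    rw [smul_comm (fderiv ℝ (g k) x (a k)) r (c k)]

omit [MeasurableSpace E] [BorelSpace E] [FiniteDimensional ℝ E] in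
/-- A finite sum of curl-type fields of scalar test functions is a (vector) test function. [folklore] -/
theorem isTestFunctionOn_curlSum {ι : Type*} [Fintype ι] {g : ι → E → ℝ}
    (hg : ∀ k, FunctionSpaces.IsTestFunctionOn (⊤ : Opens E) (g k)) (a c : ι → E) :
    FunctionSpaces.IsTestFunctionOn (⊤ : Opens E)
      fun x => ∑ k, (fderiv ℝ (g k) x (a k) • c k - fderiv ℝ (g k) x (c k) • a k) :=
  isTestFunctionOn_top_finset_sum _ fun k _ => isTestFunctionOn_curlPair (hg k) (a k) (c k)

end Tests

/-! ### Slab tools -/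

section Slab

variable {T : ℝ}

omit [InnerProductSpace ℝ E] [FiniteDimensional ℝ E] [MeasurableSpace E] [BorelSpace E] in
/-- `⟪V, Θ⟫` is integrable for `V ∈ L⁴` and `Θ ∈ L^{4/3}` (any measure space, real inner product
target). [folklore] -/
theorem integrable_inner_of_memLp_four_fourThirds' {α : Type*} [MeasurableSpace α] {μ : Measure α}
    {F : Type*} [NormedAddCommGroup F] [InnerProductSpace ℝ F] {V Θ : α → F}
    (hV4 : MemLp V 4 μ) (hΘ : MemLp Θ (4 / 3) μ) :
    Integrable (fun p => ⟪V p, Θ p⟫) μ :=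
  (integrable_norm_mul_of_four_fourThirds hV4 hΘ.norm).mono' (hV4.1.inner hΘ.1)
    (Eventually.of_forall fun _ => norm_inner_le_norm _ _)

/-- A function of `x` alone which is in `L^r(E)` is in `L^r` of the slab `(0,T) × E` (finite
time interval). [folklore] -/
theorem memLp_comp_snd_slab {G : Type*} [NormedAddCommGroup G] {φ : E → G} {r : ℝ≥0∞}
    (hφ : MemLp φ r (volume : Measure E)) (T : ℝ) :
    MemLp (fun p : ℝ × E => φ p.2) r ((volume.restrict (Ioo 0 T)).prod (volume : Measure E)) := by
  set μ : Measure (ℝ × E) := (volume.restrict (Ioo 0 T)).prod (volume : Measure E) with hμ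
  haveI : IsFiniteMeasure (volume.restrict (Ioo (0 : ℝ) T)) :=
    isFiniteMeasure_restrict.2 measure_Ioo_lt_top.ne
  have hmeas : AEStronglyMeasurable (fun p : ℝ × E => φ p.2) μ := hφ.1.comp_snd
  refine ⟨hmeas, ?_⟩
  by_cases hr0 : r = 0
  · simp [hr0]
  by_cases hrt : r = ⊤
  · subst hrt
    have hb : eLpNormEssSup φ volume < ⊤ := by
      have h := hφ.2
      rwa [eLpNorm_exponent_top] at h
    rw [eLpNorm_exponent_top]
    refine lt_of_le_of_lt (eLpNormEssSup_le_of_ae_enorm_bound ?_) hb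
    exact (Measure.quasiMeasurePreserving_snd (μ := volume.restrict (Ioo 0 T))
      (ν := (volume : Measure E))).ae (enorm_ae_le_eLpNormEssSup φ volume)
  rw [eLpNorm_lt_top_iff_lintegral_rpow_enorm_lt_top hr0 hrt,
    lintegral_prod _ (hmeas.enorm.pow_const _)]
  simp only
  rw [lintegral_const, Measure.restrict_apply MeasurableSet.univ, univ_inter]
  exact ENNReal.mul_lt_top (lintegral_rpow_enorm_lt_top_of_eLpNorm_lt_top hr0 hrt hφ.2)
    measure_Ioo_lt_top

end Slab

/-! ### The `L¹ₜL²ₓ` duality bound for finite sums of curl-type fields -/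

section SumBound

variable {ν T : ℝ} {v₀ : E → E} {v : ℝ → E → E}

/-- **The `L¹ₜL²ₓ` duality bound for finite sums of curl-type fields.** In the setting of the
vorticity-duality identity (`ν > 0`, `v` a distributional solution on `E × [0,T)` with datum
`v₀ ∈ L²`, `v ∈ L⁴` of the slab), let `θₖ` be finitely many scalar space–time test functions
vanishing for `t ≥ b` (`b < T`), `aₖ, cₖ ∈ E`, and `Φ = Σₖ [(∂_{aₖ}θₖ) cₖ - (∂_{cₖ}θₖ) aₖ]`. Then
`|∫_{(0,T)×E} ⟪v, Φ⟫| ≤ (√(2/ν) ‖v‖²_{L⁴(Q_T)} + 2‖v₀‖₂) ∫₀ᵀ ‖Φ(s)‖₂ ds`.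
Proof: the duality identity `∫∫⟪v, Φ⟫ = ∫∫⟪v, (v·∇)𝒰[Φ]⟫ + ∫⟪v₀, 𝒰[Φ](0)⟫` holds for each
summand (accepted `IsWeakNSSolutionOn.integral_inner_curlPair_eq`) and all three terms are
additive in the data (`𝒰` is linear, `heatDuhamelBack_finset_sum`), so it holds for `Φ`; then
the accepted abstract bound `abs_integral_inner_le_L1_of_duality` applies (Galdi 2019, proof of
Thm. 1.1, (2.12)–(2.15) with (2.3)). [cite: Galdi2018, proof of Thm. 1.1, (2.12)–(2.15)] -/
theorem IsWeakNSSolutionOn.abs_integral_inner_curlSum_le_L1 (hν : 0 < ν) (hT : 0 < T)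
    (hw : IsWeakNSSolutionOn T ν 0 v₀ v) (hv₀ : MemLp v₀ 2 volume)
    (hv4 : eLpNorm (uncurry v) 4 ((volume.restrict (Ioo 0 T)).prod (volume : Measure E)) < ⊤)
    {ι : Type*} [Fintype ι] {θ : ι → ℝ → E → ℝ}
    (hθ : ∀ k, IsSpaceTimeTestOn (⊤ : Opens (ℝ × E)) (θ k)) {b : ℝ} (hbT : b < T)
    (hb : ∀ k t, b ≤ t → θ k t = 0) (a c : ι → E) {Φ : ℝ → E → E}
    (hΦ : ∀ t x, Φ t x = ∑ k, ((fderiv ℝ (θ k t) x (a k)) • c k - (fderiv ℝ (θ k t) x (c k)) • a k)) :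
    |∫ p, ⟪v p.1 p.2, Φ p.1 p.2⟫ ∂((volume.restrict (Ioo 0 T)).prod (volume : Measure E))| ≤
      (Real.sqrt (2 / ν) * Real.sqrt (∫ p, ‖v p.1 p.2‖ ^ 4
          ∂((volume.restrict (Ioo 0 T)).prod (volume : Measure E))) +
        2 * Real.sqrt (∫ x, ‖v₀ x‖ ^ 2)) *
        ∫ s in (0 : ℝ)..T, Real.sqrt (∫ x, ‖Φ s x‖ ^ 2) := by
  set μ : Measure (ℝ × E) := (volume.restrict (Ioo 0 T)).prod (volume : Measure E) with hμ
  -- the summands and their Duhamel integrals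
  set Φk : ι → ℝ → E → E := fun k t x => 𝐋[a k, c k] (fderiv ℝ (θ k t) x) with hΦk_def
  have hΦk_eq : ∀ k t x, Φk k t x = (fderiv ℝ (θ k t) x (a k)) • c k - (fderiv ℝ (θ k t) x (c k)) • a k :=
    fun k t x => by simp [hΦk_def]
  have hΦk : ∀ k, IsSpaceTimeTestOn (⊤ : Opens (ℝ × E)) (Φk k) := fun k =>
    (hθ k).fderiv_top.clm_apply_top 𝐋[a k, c k]
  have hΦapply : ∀ t x, Φ t x = ∑ k, Φk k t x := fun t x => by
    rw [hΦ]; exact Finset.sum_congr rfl fun k _ => (hΦk_eq k t x).symm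
  have hΦsum : Φ = fun t x => ∑ k ∈ Finset.univ, Φk k t x := by
    funext t x; exact hΦapply t x
  have hΦt : IsSpaceTimeTestOn (⊤ : Opens (ℝ × E)) Φ := by
    rw [hΦsum]; exact isSpaceTimeTestOn_top_finset_sum _ fun k _ => hΦk k
  have hbΦk : ∀ k t, b ≤ t → Φk k t = 0 := fun k t ht => by
    funext x
    rw [Pi.zero_apply, hΦk_eq,
      show fderiv ℝ (θ k t) x = 0 from congrFun (fderiv_slice_eq_zero_of_eq_zero (hb k t ht)) x]
    simp
  have hbΦ : ∀ t, b ≤ t → Φ t = 0 := fun t ht => by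
    funext x
    rw [hΦapply, Pi.zero_apply]
    exact Finset.sum_eq_zero fun k _ => by rw [hbΦk k t ht, Pi.zero_apply]
  -- the identity for each summand
  have hvm : AEStronglyMeasurable (uncurry v) μ := aestronglyMeasurable_uncurry_prod_of_restrict hw.1
  have hV4 : MemLp (uncurry v) 4 μ := ⟨hvm, hv4⟩
  have hidk : ∀ k, ∫ p, ⟪v p.1 p.2, Φk k p.1 p.2⟫ ∂μ =
      (∫ p, ⟪v p.1 p.2, fderiv ℝ (heatDuhamelBack ν (Φk k) p.1) p.2 (v p.1 p.2)⟫ ∂μ) +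
        ∫ x, ⟪v₀ x, heatDuhamelBack ν (Φk k) 0 x⟫ := fun k =>
    hw.integral_inner_curlPair_eq hν hv₀ hv4 (hθ k) hbT (hb k) (a k) (c k) (hΦk_eq k)
  -- linearity: the Duhamel integral of `Φ` and its derivative are the sums of those of `Φk`
  set U : ℝ → E → E := heatDuhamelBack ν Φ with hU_def
  set Uk : ι → ℝ → E → E := fun k => heatDuhamelBack ν (Φk k) with hUk_def
  have hUsum : ∀ s x, U s x = ∑ k, Uk k s x := fun s x => by
    rw [hU_def, hΦsum]; exact heatDuhamelBack_finset_sum _ (fun k _ => hΦk k) hν s x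
  have hDUsum : ∀ s x w, fderiv ℝ (U s) x w = ∑ k, fderiv ℝ (Uk k s) x w := fun s x w => by
    have hfun : U s = fun y => ∑ k ∈ Finset.univ, Uk k s y := funext fun y => hUsum s y
    rw [hfun, fderiv_fun_sum fun k _ => ((hΦk k).differentiable_heatDuhamelBack hν s) x,
      _root_.sum_apply]
  -- integrability of the summands
  have iL : ∀ k, Integrable (fun p : ℝ × E => ⟪v p.1 p.2, Φk k p.1 p.2⟫) μ := fun k =>
    integrable_inner_of_memLp_four_fourThirds' hV4 ((hΦk k).memLp_slab (4 / 3) T (fun _ => rfl))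
  have iC : ∀ k, Integrable
      (fun p : ℝ × E => ⟪v p.1 p.2, fderiv ℝ (Uk k p.1) p.2 (v p.1 p.2)⟫) μ := by
    intro k
    have hD : (fun p : ℝ × E => fderiv ℝ (Uk k p.1) p.2) =
        fun p => heatDuhamelBack ν (fun t y => fderiv ℝ (Φk k t) y) p.1 p.2 :=
      funext fun p => by
        rw [hUk_def]
        exact congrFun ((hΦk k).fderiv_heatDuhamelBack hν p.1) p.2
    have hDc : Continuous fun p : ℝ × E => fderiv ℝ (Uk k p.1) p.2 := by
      rw [hD]; exact (hΦk k).fderiv_top.continuous_heatDuhamelBack hν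
    have h2 : MemLp (fun p : ℝ × E => ‖fderiv ℝ (Uk k p.1) p.2‖) 2 μ := by
      refine MemLp.norm ⟨hDc.aestronglyMeasurable, ?_⟩
      rw [hD]
      exact (hΦk k).fderiv_top.eLpNorm_heatDuhamelBack_slab_lt_top hν one_le_two
        ENNReal.ofNat_ne_top T
    have hmeas : AEStronglyMeasurable
        (fun p : ℝ × E => fderiv ℝ (Uk k p.1) p.2 (v p.1 p.2)) μ :=
      (isBoundedBilinearMap_apply (𝕜 := ℝ) (E := E) (F := E)).continuous.comp_aestronglyMeasurable
        (hDc.aestronglyMeasurable.prodMk hvm)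
    refine (integrable_norm_sq_mul_of_four_two hV4 h2).mono' (hvm.inner hmeas)
      (Eventually.of_forall fun p => ?_)
    calc ‖⟪v p.1 p.2, fderiv ℝ (Uk k p.1) p.2 (v p.1 p.2)⟫‖
        ≤ ‖v p.1 p.2‖ * ‖fderiv ℝ (Uk k p.1) p.2 (v p.1 p.2)‖ := norm_inner_le_norm _ _
      _ ≤ ‖v p.1 p.2‖ * (‖fderiv ℝ (Uk k p.1) p.2‖ * ‖v p.1 p.2‖) := by
          gcongr; exact ContinuousLinearMap.le_opNorm _ _
      _ = ‖uncurry v p‖ ^ 2 * ‖fderiv ℝ (Uk k p.1) p.2‖ := by simp only [uncurry]; ring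
  have i0 : ∀ k, Integrable (fun x => ⟪v₀ x, Uk k 0 x⟫) volume := fun k =>
    integrable_real_inner_of_memLp_two hv₀ ((hΦk k).memLp_two_heatDuhamelBack hν 0)
  -- the identity for `Φ`
  have hid : ∫ p, ⟪v p.1 p.2, Φ p.1 p.2⟫ ∂μ =
      (∫ p, ⟪v p.1 p.2, fderiv ℝ (heatDuhamelBack ν Φ p.1) p.2 (v p.1 p.2)⟫ ∂μ) +
        ∫ x, ⟪v₀ x, heatDuhamelBack ν Φ 0 x⟫ := by
    have e1 : ∫ p, ⟪v p.1 p.2, Φ p.1 p.2⟫ ∂μ = ∑ k, ∫ p, ⟪v p.1 p.2, Φk k p.1 p.2⟫ ∂μ := by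
      rw [← integral_finsetSum _ fun k _ => iL k]
      refine integral_congr_ae (Eventually.of_forall fun p => ?_)
      dsimp only
      rw [hΦapply, inner_sum]
    have e2 : ∫ p, ⟪v p.1 p.2, fderiv ℝ (heatDuhamelBack ν Φ p.1) p.2 (v p.1 p.2)⟫ ∂μ =
        ∑ k, ∫ p, ⟪v p.1 p.2, fderiv ℝ (Uk k p.1) p.2 (v p.1 p.2)⟫ ∂μ := by
      rw [← integral_finsetSum _ fun k _ => iC k]
      refine integral_congr_ae (Eventually.of_forall fun p => ?_)
      dsimp only
      rw [show heatDuhamelBack ν Φ p.1 = U p.1 from rfl, hDUsum, inner_sum]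
    have e3 : ∫ x, ⟪v₀ x, heatDuhamelBack ν Φ 0 x⟫ = ∑ k, ∫ x, ⟪v₀ x, Uk k 0 x⟫ := by
      rw [← integral_finsetSum _ fun k _ => i0 k]
      refine integral_congr_ae (Eventually.of_forall fun x => ?_)
      dsimp only
      rw [show heatDuhamelBack ν Φ 0 x = U 0 x from rfl, hUsum, inner_sum]
    rw [e1, e2, e3, ← Finset.sum_add_distrib]
    exact Finset.sum_congr rfl fun k _ => hidk k
  exact abs_integral_inner_le_L1_of_duality hν hT hvm hv₀ hv4 hΦt hbT.le hbΦ hid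

end SumBound

/-! ### Slicing in time: the a.e. bound on the pairings with a fixed curl sum -/

section AeBound

variable {ν T : ℝ} {v₀ : E → E} {v : ℝ → E → E}

/-- **A.e. bound on the slice pairings with a finite sum of curl-type fields.** In the setting
of the vorticity-duality identity, for `φ = Σₖ [(∂_{aₖ}gₖ) cₖ - (∂_{cₖ}gₖ) aₖ]` with scalar test
functions `gₖ` on `E`: `|∫ ⟪v(t), φ⟫| ≤ (√(2/ν) ‖v‖²_{L⁴(Q_T)} + 2‖v₀‖₂) ‖φ‖_{L²}` for a.e.
`t ∈ (0, T)`. Proof: test the `L¹ₜL²ₓ` bound with the products `η(t) φ(x)`,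
`η ∈ C_c^∞((0,T))` (`= Σₖ` curl-type fields of `η(t)gₖ(x)`), for which
`∫₀ᵀ ‖η(s)φ‖₂ ds = ‖φ‖₂ ∫|η|` and `∫∫⟪v, ηφ⟫ = ∫ η(t) ⟨v(t), φ⟩ dt`, and conclude with the
smooth `L¹`–`L^∞` duality `ae_abs_le_of_forall_abs_integral_mul_le` (Galdi 2019, proof of
Thm. 1.1, (2.15): "by the arbitrariness of `f`"). [cite: Galdi2018, proof of Thm. 1.1, (2.12)–(2.15)] -/
theorem IsWeakNSSolutionOn.ae_abs_integral_inner_curlSum_le (hν : 0 < ν) (hT : 0 < T)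
    (hw : IsWeakNSSolutionOn T ν 0 v₀ v) (hv₀ : MemLp v₀ 2 volume)
    (hv4 : eLpNorm (uncurry v) 4 ((volume.restrict (Ioo 0 T)).prod (volume : Measure E)) < ⊤)
    {ι : Type*} [Fintype ι] {g : ι → E → ℝ}
    (hg : ∀ k, FunctionSpaces.IsTestFunctionOn (⊤ : Opens E) (g k)) (a c : ι → E) {φ : E → E}
    (hφ : ∀ x, φ x = ∑ k, (fderiv ℝ (g k) x (a k) • c k - fderiv ℝ (g k) x (c k) • a k)) :
    ∀ᵐ t ∂(volume.restrict (Ioo 0 T)), |∫ x, ⟪v t x, φ x⟫| ≤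
      (Real.sqrt (2 / ν) * Real.sqrt (∫ p, ‖v p.1 p.2‖ ^ 4
          ∂((volume.restrict (Ioo 0 T)).prod (volume : Measure E))) +
        2 * Real.sqrt (∫ x, ‖v₀ x‖ ^ 2)) * Real.sqrt (∫ x, ‖φ x‖ ^ 2) := by
  set μ : Measure (ℝ × E) := (volume.restrict (Ioo 0 T)).prod (volume : Measure E) with hμ
  set A : ℝ := Real.sqrt (2 / ν) * Real.sqrt (∫ p, ‖v p.1 p.2‖ ^ 4 ∂μ) +
    2 * Real.sqrt (∫ x, ‖v₀ x‖ ^ 2) with hA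
  have hφt : FunctionSpaces.IsTestFunctionOn (⊤ : Opens E) φ := by
    rw [show φ = fun x => ∑ k, (fderiv ℝ (g k) x (a k) • c k - fderiv ℝ (g k) x (c k) • a k)
      from funext hφ]
    exact isTestFunctionOn_curlSum hg a c
  have hvm : AEStronglyMeasurable (uncurry v) μ := aestronglyMeasurable_uncurry_prod_of_restrict hw.1
  have hV4 : MemLp (uncurry v) 4 μ := ⟨hvm, hv4⟩
  have hφ43 : MemLp (fun p : ℝ × E => φ p.2) (4 / 3) μ :=
    memLp_comp_snd_slab (hφt.contDiff.continuous.memLp_of_hasCompactSupport hφt.hasCompactSupport) T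
  -- the slice pairing `h t = ∫ ⟪v t, φ⟫` is integrable on `(0,T)`
  set h : ℝ → ℝ := fun t => ∫ x, ⟪v t x, φ x⟫ with hh
  have hF : Integrable (fun p : ℝ × E => ⟪v p.1 p.2, φ p.2⟫) μ :=
    integrable_inner_of_memLp_four_fourThirds' hV4 hφ43
  have hhint : IntegrableOn h (Ioo 0 T) volume := hF.integral_prod_left
  -- the duality bound against smooth `η`
  have hbd : ∀ η : ℝ → ℝ, ContDiff ℝ ∞ η → HasCompactSupport η → tsupport η ⊆ Ioo 0 T →
      |∫ t in Ioo 0 T, η t * h t| ≤ (A * Real.sqrt (∫ x, ‖φ x‖ ^ 2)) * ∫ t, |η t| := by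
    intro η hη hηc hηs
    obtain ⟨a', b', h0a', hb'T, hη0⟩ := exists_Icc_of_tsupport_subset_Ioo hηc hT hηs
    obtain ⟨Cη, hCη⟩ := hη.continuous.bounded_above_of_compact_support hηc
    set b : ℝ := (b' + T) / 2 with hb_def
    have hb'b : b' < b := by rw [hb_def]; linarith
    have hbT : b < T := by rw [hb_def]; linarith
    have hηb : ∀ t, b ≤ t → η t = 0 := fun t ht => hη0 t fun hmem => by linarith [hmem.2]
    -- space–time data `θₖ(t,x) = η(t) gₖ(x)` and `Φ(t,x) = η(t) φ(x)`
    set θ : ι → ℝ → E → ℝ := fun k t x => η t • g k x with hθ_def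
    have hθ : ∀ k, IsSpaceTimeTestOn (⊤ : Opens (ℝ × E)) (θ k) := fun k =>
      isSpaceTimeTestOn_smul_top' hη hηc (hg k)
    have hθb : ∀ k t, b ≤ t → θ k t = 0 := fun k t ht => by
      funext x; simp [hθ_def, hηb t ht]
    set Φ : ℝ → E → E := fun t x => η t • φ x with hΦ_def
    have hΦ : ∀ t x, Φ t x =
        ∑ k, ((fderiv ℝ (θ k t) x (a k)) • c k - (fderiv ℝ (θ k t) x (c k)) • a k) := by
      intro t x
      have hD : ∀ k, fderiv ℝ (θ k t) x = η t • fderiv ℝ (g k) x := fun k =>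
        fderiv_const_smul ((hg k).contDiff.differentiable (by simp) x) (η t)
      simp only [hΦ_def, hφ x, Finset.smul_sum, hD, _root_.smul_apply, smul_eq_mul,
        smul_sub, mul_smul]
    have hmain := hw.abs_integral_inner_curlSum_le_L1 hν hT hv₀ hv4 hθ hbT hθb a c hΦ
    -- the right-hand side
    have hN : ∀ s, Real.sqrt (∫ x, ‖Φ s x‖ ^ 2) = |η s| * Real.sqrt (∫ x, ‖φ x‖ ^ 2) := fun s => by
      simp only [hΦ_def, norm_smul, mul_pow, Real.norm_eq_abs, integral_const_mul, sq_abs]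
      rw [Real.sqrt_mul (sq_nonneg _), Real.sqrt_sq_eq_abs]
    have hR : ∫ s in (0 : ℝ)..T, Real.sqrt (∫ x, ‖Φ s x‖ ^ 2) =
        Real.sqrt (∫ x, ‖φ x‖ ^ 2) * ∫ t, |η t| := by
      simp_rw [hN]
      rw [intervalIntegral.integral_mul_const, intervalIntegral.integral_of_le hT.le, mul_comm]
      congr 1
      refine setIntegral_eq_integral_of_forall_compl_eq_zero fun t ht => ?_
      rw [hη0 t (fun hmem => ht ⟨h0a'.trans_le hmem.1, hmem.2.trans hb'T.le⟩), abs_zero]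
    -- the left-hand side
    have hL : ∫ p, ⟪v p.1 p.2, Φ p.1 p.2⟫ ∂μ = ∫ t in Ioo 0 T, η t * h t := by
      have hptw : ∀ t x, ⟪v t x, Φ t x⟫ = η t * ⟪v t x, φ x⟫ := fun t x =>
        real_inner_smul_right _ _ _
      have hF' : Integrable (fun p : ℝ × E => ⟪v p.1 p.2, Φ p.1 p.2⟫) μ := by
        simp_rw [hptw]
        exact hF.bdd_mul (hη.continuous.comp continuous_fst).aestronglyMeasurable
          (Eventually.of_forall fun p => hCη p.1)
      rw [hμ, integral_prod _ hF']
      refine integral_congr_ae (Eventually.of_forall fun t => ?_)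
      dsimp only
      simp_rw [hptw]
      exact integral_const_mul _ _
    rw [hL, hR] at hmain
    calc |∫ t in Ioo 0 T, η t * h t| ≤ A * (Real.sqrt (∫ x, ‖φ x‖ ^ 2) * ∫ t, |η t|) := hmain
      _ = (A * Real.sqrt (∫ x, ‖φ x‖ ^ 2)) * ∫ t, |η t| := by ring
  exact ae_abs_le_of_forall_abs_integral_mul_le hhint hbd

end AeBound

/-! ### The energy class `L^∞(0,T; L²)` -/

section Energy

omit [InnerProductSpace ℝ E] [FiniteDimensional ℝ E] [MeasurableSpace E] [BorelSpace E] in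
/-- **Pairings against a fixed `L⁴` field are continuous in `L^{4/3}`.** [folklore] -/
theorem tendsto_integral_inner_of_tendsto_eLpNorm_fourThirds {α : Type*} [MeasurableSpace α]
    {μ : Measure α} {F : Type*} [NormedAddCommGroup F] [InnerProductSpace ℝ F]
    {f : α → F} {z : ℕ → α → F} {zl : α → F} (hf : MemLp f 4 μ) (hz : ∀ n, MemLp (z n) (4 / 3) μ)
    (hzl : MemLp zl (4 / 3) μ) (h : Tendsto (fun n => eLpNorm (z n - zl) (4 / 3) μ) atTop (𝓝 0)) :
    Tendsto (fun n => ∫ x, ⟪f x, z n x⟫ ∂μ) atTop (𝓝 (∫ x, ⟪f x, zl x⟫ ∂μ)) := by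
  haveI := holderTriple_four_fourThirds
  have hbound : ∀ n, edist (∫ x, ⟪f x, z n x⟫ ∂μ) (∫ x, ⟪f x, zl x⟫ ∂μ) ≤
      eLpNorm f 4 μ * eLpNorm (z n - zl) (4 / 3) μ := fun n => by
    rw [edist_eq_enorm_sub, ← integral_sub (integrable_inner_of_memLp_four_fourThirds' hf (hz n))
      (integrable_inner_of_memLp_four_fourThirds' hf hzl)]
    have heq : (fun x => ⟪f x, z n x⟫ - ⟪f x, zl x⟫) = fun x => ⟪f x, (z n - zl) x⟫ := by
      funext x; rw [Pi.sub_apply, inner_sub_right]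
    rw [heq]
    refine (enorm_integral_le_lintegral_enorm _).trans ?_
    rw [← eLpNorm_one_eq_lintegral_enorm]
    have h1 := eLpNorm_le_eLpNorm_mul_eLpNorm_of_nnnorm hf.1 ((hz n).sub hzl).1
      (fun (u w : F) => (⟪u, w⟫ : ℝ)) 1 (Eventually.of_forall fun x => by
        simpa using nnnorm_inner_le_nnnorm (f x) ((z n - zl) x)) (p := 4) (q := 4 / 3) (r := 1)
    simpa using h1
  have hlim : Tendsto (fun n => eLpNorm f 4 μ * eLpNorm (z n - zl) (4 / 3) μ) atTop (𝓝 0) := by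
    have := ENNReal.Tendsto.const_mul h (Or.inr hf.eLpNorm_ne_top)
    rwa [mul_zero] at this
  rw [tendsto_iff_edist_tendsto_0]
  exact tendsto_of_tendsto_of_tendsto_of_le_of_le tendsto_const_nhds hlim (fun _ => zero_le) hbound

variable {ν T : ℝ} {v₀ : E → E} {v : ℝ → E → E}

/-- **Galdi's class assertion, energy half: `v ∈ L^∞(0,T; L²)`** (Galdi 2019, Thm. 1.1, the
first half of "`v` is in the class (1.2)"). Let `ν > 0`, `T > 0`, and let `v` be a
distributional (pressure-free, divergence-free-tested) solution of the unforced Navier–Stokes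
system on `E × [0,T)` with datum `v₀ ∈ L²` (accepted `Fluid.IsWeakNSSolutionOn T ν 0 v₀ v`)
lying in `L⁴(0,T; L⁴)` (`Fluid.MemLqLp 4 4 v (Ioo 0 T)`). Then `v ∈ L^∞(0,T; L²)`
(`Fluid.MemLqLp ∞ 2 v (Ioo 0 T)`), and more precisely for a.e. `t ∈ (0,T)` the slice `v(t)` is
in `L²` with `‖v(t)‖_{L²} ≤ √(2/ν) ‖v‖²_{L⁴(Q_T)} + 2‖v₀‖_{L²}`. No divergence-freeness of the
datum and no dimension restriction are needed for this half. Proof: module docstring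
(duality with finite sums of curl-type fields, time slicing, exchange of quantifiers through a
countable `L² × L^{4/3}`-approximating subfamily, and `L²` by duality with curls). [cite: Galdi2018, Thm 1.1] -/
theorem IsWeakNSSolutionOn.memLqLp_top_two_of_L4 (hν : 0 < ν) (hT : 0 < T)
    (hw : IsWeakNSSolutionOn T ν 0 v₀ v) (hv₀ : MemLp v₀ 2 volume) (h₄ : MemLqLp 4 4 v (Ioo 0 T)) :
    MemLqLp ∞ 2 v (Ioo 0 T) ∧
      ∀ᵐ t ∂(volume.restrict (Ioo 0 T)), MemLp (v t) 2 volume ∧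
        eLpNorm (v t) 2 volume ≤ ENNReal.ofReal
          (Real.sqrt (2 / ν) * Real.sqrt (∫ p, ‖v p.1 p.2‖ ^ 4
              ∂((volume.restrict (Ioo 0 T)).prod (volume : Measure E))) +
            2 * Real.sqrt (∫ x, ‖v₀ x‖ ^ 2)) := by
  classical
  set μ : Measure (ℝ × E) := (volume.restrict (Ioo 0 T)).prod (volume : Measure E) with hμ
  set A : ℝ := Real.sqrt (2 / ν) * Real.sqrt (∫ p, ‖v p.1 p.2‖ ^ 4 ∂μ) +
    2 * Real.sqrt (∫ x, ‖v₀ x‖ ^ 2) with hA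
  have hA0 : 0 ≤ A := by positivity
  have hvm : AEStronglyMeasurable (uncurry v) μ := aestronglyMeasurable_uncurry_prod_of_restrict hw.1
  have hv4 : eLpNorm (uncurry v) 4 μ < ⊤ := eLpNorm_uncurry_lt_top_of_memLqLp_four hvm h₄
  -- the span `𝒦` of the curl-type fields of scalar tests
  set S : Set (E → E) := {φ : E → E | ∃ (g : E → ℝ) (a c : E),
    FunctionSpaces.IsTestFunctionOn (⊤ : Opens E) g ∧
      φ = fun x => fderiv ℝ g x a • c - fderiv ℝ g x c • a} with hS_def
  set K : Submodule ℝ (E → E) := Submodule.span ℝ S with hK_def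
  have hKtest : ∀ φ ∈ K, FunctionSpaces.IsTestFunctionOn (⊤ : Opens E) φ := fun φ hφ => by
    obtain ⟨ι, _, g, a, c, hg, rfl⟩ := exists_curlSum_of_mem_span hφ
    exact isTestFunctionOn_curlSum hg a c
  have hKmem : ∀ φ ∈ K, ∀ r : ℝ≥0∞, MemLp φ r (volume : Measure E) := fun φ hφ r =>
    (hKtest φ hφ).contDiff.continuous.memLp_of_hasCompactSupport (hKtest φ hφ).hasCompactSupport
  -- (i) for each `φ ∈ 𝒦`, the bound for a.e. `t`
  have hstep : ∀ φ ∈ K, ∀ᵐ t ∂(volume.restrict (Ioo 0 T)),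
      |∫ x, ⟪v t x, φ x⟫| ≤ A * (eLpNorm φ 2 (volume : Measure E)).toReal := by
    intro φ hφ
    obtain ⟨ι, _, g, a, c, hg, hrepr⟩ := exists_curlSum_of_mem_span hφ
    have h := hw.ae_abs_integral_inner_curlSum_le hν hT hv₀ hv4 hg a c (fun x => congrFun hrepr x)
    have heq : Real.sqrt (∫ x, ‖φ x‖ ^ 2) = (eLpNorm φ 2 (volume : Measure E)).toReal := by
      rw [← norm_toLp_sq_eq_integral_sq_norm (hKmem φ hφ 2), Real.sqrt_sq (norm_nonneg _),
        Lp.norm_toLp]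
    rw [heq] at h
    exact h
  -- (ii) a countable subfamily approximating in `L²` and `L^{4/3}` simultaneously
  haveI : Fact ((1 : ℝ≥0∞) ≤ 4 / 3) := ⟨one_le_four_thirds_and_ne_top.1⟩
  haveI : Fact ((4 / 3 : ℝ≥0∞) ≠ ⊤) := ⟨one_le_four_thirds_and_ne_top.2⟩
  haveI : Fact ((2 : ℝ≥0∞) ≠ ⊤) := ⟨ENNReal.ofNat_ne_top⟩
  let J : (E → E) → Lp E 2 (volume : Measure E) × Lp E (4 / 3) (volume : Measure E) := fun φ =>
    if hφ : MemLp φ 2 (volume : Measure E) ∧ MemLp φ (4 / 3) (volume : Measure E) then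
      (hφ.1.toLp φ, hφ.2.toLp φ) else 0
  have hJ : ∀ φ (hφ : φ ∈ K), J φ = ((hKmem φ hφ 2).toLp φ, (hKmem φ hφ (4 / 3)).toLp φ) :=
    fun φ hφ => by
    simp only [J, dif_pos (And.intro (hKmem φ hφ 2) (hKmem φ hφ (4 / 3)))]
  obtain ⟨D, hDK, hDc, hDseq⟩ := exists_countable_seq_dense J (K : Set (E → E))
  -- (iii) the a.e. good set of times
  have h1 : ∀ᵐ t ∂(volume.restrict (Ioo 0 T)), ∀ φ ∈ D,
      |∫ x, ⟪v t x, φ x⟫| ≤ A * (eLpNorm φ 2 (volume : Measure E)).toReal :=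
    (ae_ball_iff hDc).2 fun φ hφ => hstep φ (hDK hφ)
  have h2 : ∀ᵐ t ∂(volume.restrict (Ioo 0 T)), MemLp (v t) 4 (volume : Measure E) := h₄.1
  have h3 : ∀ᵐ t ∂(volume.restrict (Ioo 0 T)), IsWeaklyDivFree (v t) := hw.2.2.1
  have hgood : ∀ᵐ t ∂(volume.restrict (Ioo 0 T)), MemLp (v t) 2 (volume : Measure E) ∧
      eLpNorm (v t) 2 (volume : Measure E) ≤ ENNReal.ofReal A := by
    filter_upwards [h1, h2, h3] with t h1 h2 h3
    -- the bound extends from `D` to all of `𝒦` by continuity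
    have hbdK : ∀ φ ∈ K, |∫ x, ⟪v t x, φ x⟫| ≤ A * (eLpNorm φ 2 (volume : Measure E)).toReal := by
      intro φ hφ
      obtain ⟨u, huD, hu⟩ := hDseq φ hφ
      have huK : ∀ n, u n ∈ K := fun n => hDK (huD n)
      rw [hJ φ hφ] at hu
      have hu' : Tendsto (fun n => ((hKmem _ (huK n) 2).toLp (u n), (hKmem _ (huK n) (4 / 3)).toLp (u n)))
          atTop (𝓝 ((hKmem φ hφ 2).toLp φ, (hKmem φ hφ (4 / 3)).toLp φ)) := by
        refine hu.congr fun n => ?_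
        exact hJ _ (huK n)
      have hL2 := (continuous_fst.tendsto _).comp hu'
      have hL43 := (continuous_snd.tendsto _).comp hu'
      -- norms in `L²`
      have hn2 : Tendsto (fun n => (eLpNorm (u n) 2 (volume : Measure E)).toReal) atTop
          (𝓝 (eLpNorm φ 2 (volume : Measure E)).toReal) := by
        have h := hL2.norm
        simp only [Function.comp_def, Lp.norm_toLp] at h
        exact h
      -- convergence in `L^{4/3}`
      have hc43 : Tendsto (fun n => eLpNorm (u n - φ) (4 / 3) (volume : Measure E)) atTop (𝓝 0) := by
        have h := (Lp.tendsto_Lp_iff_tendsto_eLpNorm' _ _).1 hL43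
        refine h.congr fun n => ?_
        simp only [Function.comp_def]
        exact eLpNorm_congr_ae (((hKmem _ (huK n) (4 / 3)).coeFn_toLp).sub
          ((hKmem φ hφ (4 / 3)).coeFn_toLp))
      have hpair : Tendsto (fun n => ∫ x, ⟪v t x, u n x⟫) atTop (𝓝 (∫ x, ⟪v t x, φ x⟫)) :=
        tendsto_integral_inner_of_tendsto_eLpNorm_fourThirds h2 (fun n => hKmem _ (huK n) _)
          (hKmem φ hφ _) hc43
      exact le_of_tendsto_of_tendsto' hpair.abs (hn2.const_mul A) fun n => h1 (u n) (huD n)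
    exact memLp_two_of_forall_abs_integral_inner_curlPair_le (p := 4) (by norm_num) (by norm_num)
      h2 h3 hA0 hbdK
  refine ⟨⟨hgood.mono fun t ht => ht.1, ?_⟩, hgood⟩
  -- the essential supremum bound
  rw [eLqLpNorm, eLpNorm_exponent_top]
  refine eLpNormEssSup_lt_top_of_ae_bound (C := A) ?_
  filter_upwards [hgood] with t ht
  rw [Real.norm_eq_abs, abs_of_nonneg ENNReal.toReal_nonneg]
  exact ENNReal.toReal_le_of_le_ofReal hA0 ht.2

end Energy

end Literature.Analysis.FluidPDE
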